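import Literature.Combinatorics.Enumerative.AperyZetaThreeDworkCongruences
import Literature.Combinatorics.Enumerative.SporadicDworkCongruences
import HarnessLib

/-!
# Dwork congruences for the Domb numbers (Gorodetsky 2021, Prop. 3.3 row `(α)`)

Topic `Literature/Combinatorics/Enumerative`, namespace `Literature.Combinatorics.Enumerative.DombDworkCongruences`
(continues `SporadicDworkCongruences`; consumer of `DworkCongruences*`, `AperyZetaThreeDworkCongruences` (the
three-variable coefficient transport `toLaurent`) and `DombNumbers`).

Source, read on the page: O. Gorodetsky, *New representations for all sporadic Apéry-like sequences, with
applications to congruences*, Exp. Math. **32** (2023) 641–656 = arXiv:2102.11839 [Gorodetsky2021]: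
**Proposition 3.3**, row `(α)` (Domb numbers `u_n = Σ_k C(n,k)² C(2k,k) C(2n−2k,n−k)`, §1.1 table): the second
Laurent polynomial `(xyz)^{−1}(x + y + z + 1)(xyz + xy + yz + zx)` (§3.3: "the constant term sequences of the
Laurent polynomial `P_d = (x_1+…+x_d)(1/x_1+…+1/x_d)` with … `d = 4`", dehomogenised at `x_4 = 1`);
**Theorem 1.1** / §3.6 (its Newton polytope has the origin as only interior lattice point); **Corollary 2.4** with
**Theorem 2.3** ([SamolVanstraten2015], [MellitVlasenko2016]): the Domb numbers satisfy the D3 (Dwork) congruences.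

What is formalised (everything PROVED, no named facts):
* `dombNumer = (x_1 + S)(T x_1 + U)` with `S = 1 + x_2 + x_3`, `T = x_2x_3 + x_2 + x_3`, `U = x_2x_3`, so that
  `S·T` IS `SporadicDworkCongruences.momentNumer`; hence (`coeff_dombNumer_pow`)
  `[x_1^n] numer^n = Σ_a C(n,a)² (ST)^{n−a} U^a` and (`coeff3_dombNumer_pow`, using
  `coeff_coeff_momentNumer_pow`) `[x^n y^n z^n] numer^n = Σ_k C(n,k)² W_k` with `W_k = Σ_i C(k,i)² C(2i,i)` — which is
  the tree's NESTED definition `domb n = Σ_j C(n,j)² threeStepMoment j` (`DombNumbers`) on the nose: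
  **`ctPow_dombLaurent : CT[Λ_α^n] = domb n`**;
* `toLaurent_dombNumer` (`= (1 + x_1 + x_2 + x_3)(x_1x_2 + x_1x_3 + x_2x_3 + x_1x_2x_3)`), `suppIn_dombNumer`
  (exponents in `2·[0,1]³`), the six unit exponents (`unit_mem_support_domb`), and, by the cube criterion
  `SporadicDworkCongruences.originUnique_of_cube`, **`originUnique_dombLaurent`**;
* **`domb_dwork_congruence`**: `D_{n+mp^s} D_{⌊n/p⌋} ≡ D_n D_{⌊(n+mp^s)/p⌋} (mod p^s)` for every prime `p` and all
  `s, m, n ≥ 0` (the printed (D3) shape).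

Nearest existing declarations (used, not restated): `Enumerative.domb`, `Enumerative.threeStepMoment` (`DombNumbers`),
`DombLucasCongruences.domb_modEq_mul` (the case `s = 1`, by a different route), `SporadicDworkCongruences.*`,
`AperyZetaThreeDworkCongruences.{expVec, X1, X2, X3, toLaurent, toL2, toL1, coeff_toLaurent}`,
`AperyDworkCongruences.{q, q_coeff, q_sq_coeff, latticeEmb_apply}`.
-/

noncomputable section

open Finset Polynomial Pointwise

namespace Literature.Combinatorics.Enumerative.DombDworkCongruences

open Literature.NumberTheory.Congruences.DworkCongruences
open Literature.Combinatorics.Enumerative.AperyDworkCongruences (q q_coeff q_sq_coeff latticeEmb_apply)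
open Literature.Combinatorics.Enumerative.AperyZetaThreeDworkCongruences (expVec expVec_zero expVec_one expVec_two
  expVec_add nsmul_expVec X1 X2 X3 toL1 toL2 coeff_toLaurent)
open Literature.Combinatorics.Enumerative.SporadicDworkCongruences (unitCube convex_unitCube zero_mem_unitCube
  suppIn_unitCube_single suppIn_unitCube_one negOnes support_mul_single_negOnes originUnique_of_cube momentNumer
  coeff_coeff_momentNumer_pow momentNumer_coeff_two momentNumer_coeff_one momentNumer_coeff_zero)

/-! ## A coefficient formula for powers of a linear polynomial -/

/-- `[X^b] (tX + u)^n = t^b u^{n−b} C(n,b)` (`b ≤ n`). [cite: Gorodetsky2021, Prop. 3.3 (proof device; binomial theorem)] -/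
theorem coeff_C_mul_X_add_C_pow {R : Type*} [CommSemiring R] (t u : R) {n b : ℕ} (hb : b ≤ n) :
    ((C t * X + C u) ^ n).coeff b = t ^ b * u ^ (n - b) * (n.choose b : R) := by
  have term_eq : ∀ m : ℕ, (C t * X) ^ m * (C u) ^ (n - m) * (n.choose m : R[X]) =
      C (t ^ m * u ^ (n - m) * (n.choose m : R)) * X ^ m := fun m => by
    simp only [mul_pow, map_mul, map_pow, map_natCast]
    ring
  rw [add_pow, finsetSum_coeff]
  simp_rw [term_eq, coeff_C_mul_X_pow]
  rw [Finset.sum_ite_eq, if_pos (Finset.mem_range.2 (Nat.lt_succ_of_le hb))]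

/-! ## The Laurent polynomial `Λ_α = (1 + x_1 + x_2 + x_3)(x_1x_2x_3 + x_1x_2 + x_1x_3 + x_2x_3)/(x_1x_2x_3)` -/

/-- `S = 1 + x_2 + x_3` (a polynomial in `x_2` over `ℤ[x_3]`). [cite: Gorodetsky2021, Prop. 3.3 (row `(α)`)] -/
def S : ℤ[X][X] := X + C q

/-- `T = x_2x_3 + x_2 + x_3 = (1 + x_3) x_2 + x_3`. [cite: Gorodetsky2021, Prop. 3.3 (row `(α)`)] -/
def T : ℤ[X][X] := C q * X + C X

/-- `U = x_2x_3`. [cite: Gorodetsky2021, Prop. 3.3 (row `(α)`)] -/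
def U : ℤ[X][X] := C X * X

/-- `S · T` is the numerator of `SporadicDworkCongruences.momentLaurent`. [cite: Gorodetsky2021, Prop. 3.3 (rows **C**, `(α)`)] -/
theorem S_mul_T : S * T = momentNumer := rfl

/-- The numerator `(x_1 + x_2 + x_3 + 1)(x_1x_2x_3 + x_1x_2 + x_2x_3 + x_3x_1) = (x_1 + S)(T x_1 + U)` as a polynomial
in `x_1` over `ℤ[x_3][x_2]`. [cite: Gorodetsky2021, Prop. 3.3 (row `(α)`)] -/
def dombNumer : ℤ[X][X][X] := (X + C S) * (C T * X + C U)

/-- Gorodetsky's Laurent polynomial for `(α)`: `Λ_α = (x + y + z + 1)(xyz + xy + yz + zx)/(xyz)`.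
[cite: Gorodetsky2021, Prop. 3.3 (row `(α)`)] -/
def dombLaurent : LaurentPoly ℤ 3 :=
  AperyZetaThreeDworkCongruences.toLaurent dombNumer * AddMonoidAlgebra.single (negOnes 3) 1

/-! ## `CT[Λ_α^n] = D_n` -/

/-- `[x_1^n] numer^n = Σ_a C(n,a)² (ST)^{n−a} U^a`. [cite: Gorodetsky2021, Prop. 3.3 (row `(α)`)] -/
theorem coeff_dombNumer_pow (n : ℕ) : (dombNumer ^ n).coeff n =
    ∑ a ∈ range (n + 1), ((n.choose a : ℤ[X][X]) * (n.choose a : ℤ[X][X])) * (momentNumer ^ (n - a) * U ^ a) := by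
  rw [dombNumer, mul_pow (M := ℤ[X][X][X]), coeff_mul, Finset.Nat.sum_antidiagonal_eq_sum_range_succ_mk]
  refine Finset.sum_congr rfl fun a ha => ?_
  rw [Finset.mem_range, Nat.lt_succ_iff] at ha
  simp only
  rw [coeff_X_add_C_pow, coeff_C_mul_X_add_C_pow T U (Nat.sub_le n a), Nat.sub_sub_self ha, Nat.choose_symm ha,
    ← S_mul_T, mul_pow]
  ring

/-- `[x_1^n x_2^n x_3^n] numer^n = Σ_k C(n,k)² W_k = D_n` (the tree's nested `domb`).
[cite: Gorodetsky2021, Prop. 3.3 (row `(α)`), §1.1 (table: `(α)` Domb numbers)] -/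
theorem coeff3_dombNumer_pow (n : ℕ) : (((dombNumer ^ n).coeff n).coeff n).coeff n = (domb n : ℤ) := by
  rw [coeff_dombNumer_pow, finsetSum_coeff, finsetSum_coeff, domb, ← Finset.sum_range_reflect _ (n + 1), Nat.cast_sum]
  refine Finset.sum_congr rfl fun a ha => ?_
  have ha' : a ≤ n := by rw [Finset.mem_range] at ha; omega
  rw [Nat.add_sub_cancel, ← C_eq_natCast, ← map_mul, coeff_C_mul, Nat.sub_sub_self ha', Nat.choose_symm ha',
    show momentNumer ^ a * U ^ (n - a) = C (X ^ (n - a)) * (X ^ (n - a) * momentNumer ^ a) by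
      rw [U, mul_pow, ← map_pow]; ring,
    coeff_C_mul, coeff_X_pow_mul', if_pos (Nat.sub_le n a), Nat.sub_sub_self ha', ← C_eq_natCast, ← map_mul,
    coeff_C_mul, coeff_X_pow_mul', if_pos (Nat.sub_le n a), Nat.sub_sub_self ha', coeff_coeff_momentNumer_pow]
  push_cast
  ring

/-- `−(n • (−1,−1,−1)) = (n,n,n)`. [cite: Gorodetsky2021, Prop. 3.3] -/
theorem neg_nsmul_negOnes_three (n : ℕ) : -(n • negOnes 3) = expVec (n : ℤ) (n : ℤ) (n : ℤ) := by
  ext k; fin_cases k <;> simp [negOnes]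

/-- **`CT[Λ_α^n] = D_n`.** [cite: Gorodetsky2021, Prop. 3.3 (row `(α)`)] -/
theorem ctPow_dombLaurent (n : ℕ) : ctPow dombLaurent n = (domb n : ℤ) := by
  unfold ctPow constTerm dombLaurent
  rw [mul_pow, ← map_pow, AddMonoidAlgebra.single_pow, one_pow, AddMonoidAlgebra.coeff_mul_single_apply, mul_one,
    zero_add, neg_nsmul_negOnes_three, coeff_toLaurent, coeff3_dombNumer_pow]

/-! ## The Newton polytope -/

/-- `Λ_α · x_1x_2x_3 = (1 + x_1 + x_2 + x_3)(x_1x_2 + x_1x_3 + x_2x_3 + x_1x_2x_3)` in the Laurent ring.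
[cite: Gorodetsky2021, Prop. 3.3 (row `(α)`)] -/
theorem toLaurent_dombNumer : AperyZetaThreeDworkCongruences.toLaurent dombNumer =
    (1 + X1 + X2 + X3) * (X1 * X2 + X1 * X3 + X2 * X3 + X1 * X2 * X3) := by
  simp only [AperyZetaThreeDworkCongruences.toLaurent, toL2, toL1, dombNumer, S, T, U, q, Polynomial.coe_eval₂RingHom,
    eval₂_mul, eval₂_add, eval₂_C, eval₂_X, eval₂_one]
  ring

/-- `supp x_i ⊂ [0,1]³`. [cite: Gorodetsky2021, §3.6] -/
theorem suppIn_X :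
    SuppIn (unitCube 3) X1 1 ∧ SuppIn (unitCube 3) X2 1 ∧ SuppIn (unitCube 3) X3 1 :=
  ⟨suppIn_unitCube_single (fun i => by fin_cases i <;> simp) 1,
    suppIn_unitCube_single (fun i => by fin_cases i <;> simp) 1,
    suppIn_unitCube_single (fun i => by fin_cases i <;> simp) 1⟩

/-- The square-free monomials `x_1x_2, x_1x_3, x_2x_3, x_1x_2x_3`. [cite: Gorodetsky2021, Prop. 3.3 (row `(α)`)] -/
theorem monomials_eq :
    X1 * X2 = AddMonoidAlgebra.single (expVec 1 1 0) 1 ∧ X1 * X3 = AddMonoidAlgebra.single (expVec 1 0 1) 1 ∧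
    X2 * X3 = AddMonoidAlgebra.single (expVec 0 1 1) 1 ∧
    X1 * X2 * X3 = AddMonoidAlgebra.single (expVec 1 1 1) 1 := by
  refine ⟨?_, ?_, ?_, ?_⟩ <;>
    simp only [X1, X2, X3, AddMonoidAlgebra.single_mul_single, expVec_add, mul_one] <;> norm_num

/-- `supp` of the square-free monomials `⊂ [0,1]³`. [cite: Gorodetsky2021, §3.6] -/
theorem suppIn_monomials :
    SuppIn (unitCube 3) (X1 * X2) 1 ∧ SuppIn (unitCube 3) (X1 * X3) 1 ∧ SuppIn (unitCube 3) (X2 * X3) 1 ∧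
    SuppIn (unitCube 3) (X1 * X2 * X3) 1 := by
  obtain ⟨h12, h13, h23, h123⟩ := monomials_eq
  rw [h123, h12, h13, h23]
  exact ⟨suppIn_unitCube_single (fun i => by fin_cases i <;> simp) 1,
    suppIn_unitCube_single (fun i => by fin_cases i <;> simp) 1,
    suppIn_unitCube_single (fun i => by fin_cases i <;> simp) 1,
    suppIn_unitCube_single (fun i => by fin_cases i <;> simp) 1⟩

/-- The numerator's exponents lie in `2 · [0,1]³`. [cite: Gorodetsky2021, §3.6] -/
theorem suppIn_dombNumer : SuppIn (unitCube 3) (AperyZetaThreeDworkCongruences.toLaurent dombNumer) 2 := by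
  obtain ⟨h1, h2, h3⟩ := suppIn_X
  obtain ⟨h12, h13, h23, h123⟩ := suppIn_monomials
  have hA : SuppIn (unitCube 3) (1 + X1 + X2 + X3) 1 := ((suppIn_unitCube_one.add h1).add h2).add h3
  have hB : SuppIn (unitCube 3) (X1 * X2 + X1 * X3 + X2 * X3 + X1 * X2 * X3) 1 := ((h12.add h13).add h23).add h123
  rw [toLaurent_dombNumer, show (2 : ℝ) = 1 + 1 by norm_num]
  exact hA.mul convex_unitCube hB zero_le_one zero_le_one

/-- `numer = T x_1² + (U + ST) x_1 + SU`. [cite: Gorodetsky2021, Prop. 3.3 (row `(α)`)] -/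
theorem dombNumer_eq : dombNumer = C T * X ^ 2 + C (U + S * T) * X + C (S * U) := by
  simp only [dombNumer, map_add, map_mul]
  ring

/-- `[x_1²] numer = T`. [cite: Gorodetsky2021, Prop. 3.3 (row `(α)`)] -/
theorem dombNumer_coeff_two : dombNumer.coeff 2 = T := by
  rw [dombNumer_eq]
  simp only [coeff_add, coeff_C_mul_X_pow, coeff_C_mul_X, coeff_C]
  simp

/-- `[x_1] numer = U + ST`. [cite: Gorodetsky2021, Prop. 3.3 (row `(α)`)] -/
theorem dombNumer_coeff_one : dombNumer.coeff 1 = U + momentNumer := by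
  rw [dombNumer_eq, S_mul_T]
  simp only [coeff_add, coeff_C_mul_X_pow, coeff_C_mul_X, coeff_C]
  simp

/-- `[x_1⁰] numer = SU`. [cite: Gorodetsky2021, Prop. 3.3 (row `(α)`)] -/
theorem dombNumer_coeff_zero : dombNumer.coeff 0 = S * U := by
  rw [dombNumer_eq]
  simp only [coeff_add, coeff_C_mul_X_pow, coeff_C_mul_X, coeff_C]
  simp

/-- `[x_2] T = 1 + x_3`. [cite: Gorodetsky2021, Prop. 3.3 (row `(α)`)] -/
theorem T_coeff_one : T.coeff 1 = q := by
  rw [T]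
  simp only [coeff_add, coeff_C_mul_X, coeff_C]
  simp

/-- `SU = x_3 x_2² + x_3(1+x_3) x_2`. [cite: Gorodetsky2021, Prop. 3.3 (row `(α)`)] -/
theorem S_mul_U : S * U = C X * X ^ 2 + C (q * X) * X := by
  simp only [S, U, map_mul]
  ring

/-- `[x_2] SU = x_3(1+x_3)`. [cite: Gorodetsky2021, Prop. 3.3 (row `(α)`)] -/
theorem SU_coeff_one : (S * U).coeff 1 = q * X := by
  rw [S_mul_U]
  simp only [coeff_add, coeff_C_mul_X_pow, coeff_C_mul_X]
  simp

/-- `[x_2²] (U + ST) = 1 + x_3`. [cite: Gorodetsky2021, Prop. 3.3 (row `(α)`)] -/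
theorem UST_coeff_two : (U + momentNumer).coeff 2 = q := by
  rw [coeff_add, momentNumer_coeff_two, U, coeff_C_mul_X]
  simp

/-- `[x_2] (U + ST) = x_3 + ((1+x_3)² + x_3)`. [cite: Gorodetsky2021, Prop. 3.3 (row `(α)`)] -/
theorem UST_coeff_one : (U + momentNumer).coeff 1 = X + (q ^ 2 + X) := by
  rw [coeff_add, momentNumer_coeff_one, U, coeff_C_mul_X]
  simp

/-- `[x_2⁰] (U + ST) = x_3(1+x_3)`. [cite: Gorodetsky2021, Prop. 3.3 (row `(α)`)] -/
theorem UST_coeff_zero : (U + momentNumer).coeff 0 = q * X := by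
  rw [coeff_add, momentNumer_coeff_zero, U, coeff_C_mul_X]
  simp

/-- Coefficients of `Λ_α` in terms of the numerator. [cite: Gorodetsky2021, Prop. 3.3 (row `(α)`)] -/
theorem coeff_dombLaurent (a b c : ℤ) (i j k : ℕ) (ha : a + 1 = i) (hb : b + 1 = j) (hc : c + 1 = k) :
    dombLaurent.coeff (expVec a b c) = ((dombNumer.coeff i).coeff j).coeff k := by
  rw [dombLaurent, AddMonoidAlgebra.coeff_mul_single_apply, mul_one,
    show expVec a b c + -negOnes 3 = expVec (i : ℤ) (j : ℤ) (k : ℤ) by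
      rw [← ha, ← hb, ← hc]; ext l; fin_cases l <;> simp [negOnes],
    coeff_toLaurent]

/-- `∀` over `Fin 3` as a conjunction (plumbing). [folklore] -/
private theorem forall_fin_three {P : Fin 3 → Prop} : (∀ i, P i) ↔ P 0 ∧ P 1 ∧ P 2 :=
  ⟨fun h => ⟨h 0, h 1, h 2⟩, fun h i => by fin_cases i <;> [exact h.1; exact h.2.1; exact h.2.2]⟩

/-- `Pi.single i c` as `expVec`. [cite: Gorodetsky2021, Prop. 3.3] -/
theorem single_eq_expVec3 (c : ℤ) : (Pi.single 0 c : Fin 3 → ℤ) = expVec c 0 0 ∧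
    (Pi.single 1 c : Fin 3 → ℤ) = expVec 0 c 0 ∧ (Pi.single 2 c : Fin 3 → ℤ) = expVec 0 0 c := by
  refine ⟨?_, ?_, ?_⟩ <;> (ext k; fin_cases k <;> simp)

/-- The exponents `±e_1, ±e_2, ±e_3` occur in `Λ_α` (all with coefficient `1`). [cite: Gorodetsky2021, §3.6] -/
theorem unit_mem_support_domb :
    (∀ i : Fin 3, Pi.single i (1 : ℤ) ∈ dombLaurent.coeff.support) ∧
      ∀ i : Fin 3, Pi.single i (-1 : ℤ) ∈ dombLaurent.coeff.support := by
  obtain ⟨p0, p1, p2⟩ := single_eq_expVec3 1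
  obtain ⟨m0, m1, m2⟩ := single_eq_expVec3 (-1)
  rw [forall_fin_three, forall_fin_three, p0, p1, p2, m0, m1, m2]
  simp only [Finsupp.mem_support_iff]
  refine ⟨⟨?_, ?_, ?_⟩, ?_, ?_, ?_⟩
  · rw [coeff_dombLaurent 1 0 0 2 1 1 (by norm_num) (by norm_num) (by norm_num), dombNumer_coeff_two, T_coeff_one,
      q_coeff]
    simp
  · rw [coeff_dombLaurent 0 1 0 1 2 1 (by norm_num) (by norm_num) (by norm_num), dombNumer_coeff_one, UST_coeff_two,
      q_coeff]
    simp
  · rw [coeff_dombLaurent 0 0 1 1 1 2 (by norm_num) (by norm_num) (by norm_num), dombNumer_coeff_one, UST_coeff_one,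
      coeff_add, coeff_add, q_sq_coeff, coeff_X]
    simp
  · rw [coeff_dombLaurent (-1) 0 0 0 1 1 (by norm_num) (by norm_num) (by norm_num), dombNumer_coeff_zero,
      SU_coeff_one, coeff_mul_X, q_coeff]
    simp
  · rw [coeff_dombLaurent 0 (-1) 0 1 0 1 (by norm_num) (by norm_num) (by norm_num), dombNumer_coeff_one,
      UST_coeff_zero, coeff_mul_X, q_coeff]
    simp
  · rw [coeff_dombLaurent 0 0 (-1) 1 1 0 (by norm_num) (by norm_num) (by norm_num), dombNumer_coeff_one,
      UST_coeff_one, coeff_add, coeff_add, q_sq_coeff, coeff_X_zero]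
    simp

/-- The Newton polytope of `Λ_α` has the origin as its only interior lattice point.
[cite: Gorodetsky2021, Thm. 1.1 / §3.6 (row `(α)`)] -/
theorem originUnique_dombLaurent : OriginUniqueInteriorLatticePoint dombLaurent :=
  originUnique_of_cube dombLaurent three_pos
    (fun _ hv => by rw [dombLaurent] at hv; exact support_mul_single_negOnes suppIn_dombNumer hv)
    unit_mem_support_domb.1 unit_mem_support_domb.2

/-- **Dwork (D3) congruences for the Domb numbers** `D_n = Σ_k C(n,k)² C(2k,k) C(2n−2k,n−k)`, in the printed form
(D3): for every prime `p` and all `s, m, n ≥ 0`, `D_{n+mp^s} D_{⌊n/p⌋} ≡ D_n D_{⌊(n+mp^s)/p⌋} (mod p^s)`.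
[cite: Gorodetsky2021, Cor. 2.4 with (D3) of §2.1 (Prop. 3.3 row `(α)`, Thm. 2.3)] -/
theorem domb_dwork_congruence {p : ℕ} (hp : p.Prime) (s m n : ℕ) :
    (domb (n + m * p ^ s) : ℤ) * domb (n / p) ≡ domb n * domb ((n + m * p ^ s) / p) [ZMOD (p : ℤ) ^ s] := by
  rcases Nat.eq_zero_or_pos s with rfl | hs
  · rw [pow_zero]
    exact Int.modEq_one
  have hR : ∀ a : ℤ, (p : ℤ) ∣ a ^ p - a := fun a => by
    haveI := Fact.mk hp
    rw [← ZMod.intCast_zmod_eq_zero_iff_dvd]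
    push_cast
    rw [ZMod.pow_card, sub_self]
  have h := dwork_congruence hp hR dombLaurent originUnique_dombLaurent hs n m
  simp only [ctPow_dombLaurent] at h
  have hdiv : (n + m * p ^ s) / p = n / p + m * p ^ (s - 1) := by
    obtain ⟨t, rfl⟩ : ∃ t, s = t + 1 := ⟨s - 1, by omega⟩
    rw [Nat.add_sub_cancel, pow_succ, ← mul_assoc, Nat.add_mul_div_right _ _ hp.pos]
  rw [hdiv]
  exact (Int.modEq_iff_dvd.2 h).symm

end Literature.Combinatorics.Enumerative.DombDworkCongruences
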